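import Mathlib.RepresentationTheory.Homological.GroupCohomology.Hilbert90
import Literature.Algebra.Homology.CrossedHomCoboundaryCriteria
import Literature.NumberTheory.GaloisRepresentations.HasseNormCyclicIdelic
import Literature.NumberTheory.Automorphic.IdeleClassCharacterConjugate
import Literature.NumberTheory.Automorphic.IdeleClassBaseChangeInjective
import Literature.NumberTheory.Automorphic.IdeleNormTowerProofs
import Literature.NumberTheory.NumberFields.IdelicArtinMapAutomorphism
import HarnessLib

/-!
# `H¹(Gal(E/F), C_E) = 0` in cocycle form: cyclic layers, Galois descent of idele classes, and the
# inflation–restriction step (Tate, Cassels–Fröhlich Ch. VII §9 Thm. 9.1; Neukirch, *Bonn Lectures* III §2)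

Topic `NumberTheory/Automorphic` (ideles, idele classes); namespace
`Literature.NumberTheory.Automorphic.IdeleClassGroup`.  Proof file: theorems only (no definition, no named
fact, no instance; D-0026).

The first axiom of the global class formation `(Gal(E/F), C_E)` (Tate, Cassels–Fröhlich Ch. VII §9
Thm. 9.1: "`H¹(G, C_L) = 0` for every finite Galois `L/K`") is proved in print in three steps: (1) cyclic
layers — `#Ĥ⁰ = [L:K]·#Ĥ⁻¹` (first inequality, Herbrand quotient) and `#Ĥ⁰ = [C_K : N C_L] = [L:K]` give
`Ĥ⁻¹(G, C_L) = H¹(G, C_L) = 0`; (2) solvable groups (in particular `p`-groups) by induction through the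
exact inflation–restriction sequence `0 → H¹(G/N, C_L^N) → H¹(G, C_L) → H¹(N, C_L)` with `C_L^N = C_{L^N}`
(Galois descent, Neukirch III (2.7): `H⁰(G, C_L) = C_K`); (3) arbitrary `G` from its Sylow subgroups by
restriction–corestriction.  The tree proves (1) in ELEMENT form in every universe
(`GaloisRepresentations.IdeleHerbrand.exists_eq_principal_mul_twist_of_ideleGalNorm_mem`: an idele of `E`
whose Galois norm is principal is `(k)·(σ z / z)`, i.e. `Ĥ⁻¹(G; J_E, Eˣ) = 1`, unconditionally).

This file supplies, for the idele class group `C_E = IdeleClassGroup E` (`𝕀_E / Eˣ`) with its Galois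
action `classGalAct σ : C_E →ₜ* C_E` (`IdeleClassCharacterConjugate`; no `MulAction` instance is registered
on `C_E`, so crossed homomorphisms `f (g h) = g • f h · f g` and coboundaries `g ↦ g • c / c` are spelled out,
in the convention of Mathlib's `groupCohomology.IsMulCocycle₁ / IsMulCoboundary₁`), using the elementary
criteria of `Algebra/Homology/CrossedHomCoboundaryCriteria`:

* §1 **`exists_classGalAct_div_eq_of_isCyclic`** — step (1) in COCYCLE form: for `E/F` cyclic every crossed
  homomorphism `Gal(E/F) → C_E` is a coboundary (from `Ĥ⁻¹ = 1` via `x ↦ x(σ)`, Neukirch I (6.1)).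
* §2 **`exists_classBaseChange_eq_of_forall_classGalAct_eq`** — Galois descent for idele CLASSES,
  `C_E^{Gal(E/M)} = ι(C_M)` (Neukirch III (2.7) `H⁰(G, C_L) = C_K`): a class fixed by `Gal(E/M)` comes from
  `C_M` (`σ y / y = (a_σ)` is a `1`-cocycle `Gal(E/M) → Eˣ`, a coboundary by Hilbert 90
  (`groupCohomology.isMulCoboundary₁_of_isMulCocycle₁_of_aut_to_units`), and `y/(b)` is `Gal(E/M)`-fixed,
  hence an idele of `M`, `AdeleRing.mem_range_ideleBaseChange_of_forall_smul_eq`); the compatibilities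
  `g • ι(a) = ι(g|_M • a)` (`AdeleRing.smul_ideleBaseChange_tower`) and "`τ ∈ Gal(E/M)` acts on `C_E` as
  `τ|^F`" (`NumberFields.ideleGroup.smul_eq_smul_of_forall_apply_eq`).
* §3 **`exists_classGalAct_div_eq_of_tower`** — step (2), ONE inflation–restriction step for a tower
  `F ⊆ M ⊆ E` of number fields with `E/F`, `M/F` (hence `E/M`) Galois: if every crossed homomorphism
  `Gal(E/M) → C_E` and every crossed homomorphism `Gal(M/F) → C_M` is a coboundary, so is every crossed
  homomorphism `Gal(E/F) → C_E` (the kernel of `Gal(E/F) → Gal(M/F)`, `AlgEquiv.restrictNormalHom`, is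
  `Gal(E/M)` via `AlgEquiv.restrictScalars`; `C_M → C_E` is injective, `classBaseChange_injective`).

The induction over solvable Galois groups and the Sylow / corestriction step (3) are not in this file.

## References

* J. W. S. Cassels, A. Fröhlich (eds.), *Algebraic Number Theory* (1967), Ch. VII (J. Tate, *Global class
  field theory*) §9 Thm. 9.1 and its proof, §11.4. [CasselsFrohlichANT1967]
* J. Neukirch, *Class Field Theory — The Bonn Lectures* (ed. A. Schmidt, 2013), Part I §6 Thm. (6.1);
  Part III §2 (2.5)–(2.7) (`I_L^G = I_K`, `L^× ∩ I_K = K^×`, `H⁰(G, C_L) = C_K`). [Neukirch2013]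
* J.-P. Serre, *Local Fields*, GTM 67 (1979), Ch. VII §6 Prop. 4 (inflation–restriction), Ch. X §1
  Prop. 2 (Hilbert's Theorem 90). [SerreLocalFields1979]
-/

noncomputable section

open NumberField
open scoped NumberField

namespace Literature.NumberTheory.Automorphic

namespace IdeleClassGroup

open Literature.NumberTheory.GaloisRepresentations
open Literature.Algebra.Homology

/-! ## §0. The Galois action on `C_E` as a family of endomorphisms -/

section Action

variable {F E : Type} [Field F] [Field E] [Algebra F E] [NumberField E]

/-- `(g h) • c = g • (h • c)` on idele classes, for the family `g ↦ classGalAct g` viewed as monoid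
endomorphisms. [cite: CasselsFrohlichANT1967, Ch. VII §8 (action of `G` on `C_L`)] -/
theorem classGalAct_toMonoidHom_mul (g h : E ≃ₐ[F] E) (c : IdeleClassGroup E) :
    (classGalAct (g * h)).toMonoidHom c = (classGalAct g).toMonoidHom ((classGalAct h).toMonoidHom c) :=
  (classGalAct_classGalAct g h c).symm

/-- `1 • c = c` on idele classes. [cite: CasselsFrohlichANT1967, Ch. VII §8 (action of `G` on `C_L`)] -/
theorem classGalAct_toMonoidHom_one (c : IdeleClassGroup E) :
    (classGalAct (1 : E ≃ₐ[F] E)).toMonoidHom c = c :=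
  classGalAct_one_apply c

end Action

/-! ## §1. Cyclic layers: every crossed homomorphism `Gal(E/F) → C_E` is a coboundary -/

section Cyclic

variable {F E : Type} [Field F] [Field E] [Algebra F E] [NumberField F] [NumberField E]

/-- **`Ĥ⁻¹(Gal(E/F), C_E) = 0` for `E/F` cyclic, on classes**: an idele class killed by the Galois norm
`N̄ = ∏_{g} g •` is `σ • d / d` for the generator `σ` (the tree's element form
`IdeleHerbrand.exists_eq_principal_mul_twist_of_ideleGalNorm_mem` read on `C_E = 𝕀_E / Eˣ`).
[cite: CasselsFrohlichANT1967, Ch. VII §9 Thm. 9.1 (2)] -/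
theorem exists_classGalAct_div_eq_of_prod_eq_one [IsGalois F E] {σ : E ≃ₐ[F] E}
    (hσ : ∀ τ : E ≃ₐ[F] E, τ ∈ Subgroup.zpowers σ) (c : IdeleClassGroup E)
    (hc : ∏ g : E ≃ₐ[F] E, classGalAct g c = 1) :
    ∃ d : IdeleClassGroup E, classGalAct σ d / d = c := by
  classical
  obtain ⟨y, rfl⟩ := QuotientGroup.mk_surjective c
  have hmem : AdeleRing.ideleGalNorm F E y ∈ principalIdeles E := by
    rw [← QuotientGroup.eq_one_iff, AdeleRing.ideleGalNorm_apply, QuotientGroup.mk_prod]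
    exact hc
  obtain ⟨k, z, hz⟩ := IdeleHerbrand.exists_eq_principal_mul_twist_of_ideleGalNorm_mem hσ hmem
  refine ⟨(z : IdeleClassGroup E), ?_⟩
  rw [classGalAct_mk, ← QuotientGroup.mk_div, QuotientGroup.eq, hz, mul_comm (IdeleHerbrand.principal E k),
    inv_mul_cancel_left]
  exact ⟨k, rfl⟩

/-- **`H¹(Gal(E/F), C_E) = 0` for a cyclic extension of number fields, cocycle form** (Tate,
Cassels–Fröhlich Ch. VII §9 Thm. 9.1 for cyclic `G`): every crossed homomorphism `f : Gal(E/F) → C_E`,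
`f (g h) = g • f h · f g`, is a coboundary `f g = g • c / c`.  From `Ĥ⁻¹ = 0`
(`exists_classGalAct_div_eq_of_prod_eq_one`) by the elementary criterion
`CrossedHomElem.exists_coboundary_of_isCyclic_of_normKer` (`x ↦ x(σ)`, Neukirch I (6.1)).
[cite: CasselsFrohlichANT1967, Ch. VII §9 Thm. 9.1 (2)] -/
theorem exists_classGalAct_div_eq_of_isCyclic [IsGalois F E] [IsCyclic (E ≃ₐ[F] E)]
    (f : (E ≃ₐ[F] E) → IdeleClassGroup E) (hf : ∀ g h, f (g * h) = classGalAct g (f h) * f g) :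
    ∃ c : IdeleClassGroup E, ∀ g, classGalAct g c / c = f g := by
  obtain ⟨σ, hσ⟩ := IsCyclic.exists_generator (α := E ≃ₐ[F] E)
  exact CrossedHomElem.exists_coboundary_of_isCyclic_of_normKer
    (fun g : E ≃ₐ[F] E => (classGalAct g : IdeleClassGroup E →ₜ* IdeleClassGroup E).toMonoidHom)
    classGalAct_toMonoidHom_mul classGalAct_toMonoidHom_one hσ
    (fun c hc => exists_classGalAct_div_eq_of_prod_eq_one hσ c hc) hf

end Cyclic

/-! ## §2. Galois descent for idele classes: `C_E^{Gal(E/M)} = ι(C_M)` -/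

section Descent

variable {M E : Type} [Field M] [Field E] [Algebra M E] [NumberField M] [NumberField E]

/-- **Galois descent for idele classes (`H⁰(G, C_E) = C_M`, Neukirch III (2.7))**: for `E/M` a finite
Galois extension of number fields, an idele class of `E` fixed by `Gal(E/M)` is the base change of an
idele class of `M`.  If `[y]` is fixed, `σ • y / y = (a_σ)` with `a : Gal(E/M) → Eˣ` a `1`-cocycle
(`(a)_𝔸` is injective and equivariant), hence `a_σ = σ b / b` by Hilbert's Theorem 90
(`groupCohomology.isMulCoboundary₁_of_isMulCocycle₁_of_aut_to_units`); then `y / (b)` is `Gal(E/M)`-fixed,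
so it is an idele of `M` (`𝕀_E^{Gal(E/M)} = 𝕀_M`, `AdeleRing.mem_range_ideleBaseChange_of_forall_smul_eq`).
[cite: Neukirch2013, Part III §2 (2.7)] -/
theorem exists_classBaseChange_eq_of_forall_classGalAct_eq [IsGalois M E] (c : IdeleClassGroup E)
    (hc : ∀ τ : E ≃ₐ[M] E, classGalAct τ c = c) :
    ∃ a : IdeleClassGroup M, classBaseChange M E a = c := by
  haveI : FiniteDimensional M E := Module.Finite.of_restrictScalars_finite ℚ M E
  obtain ⟨y, rfl⟩ := QuotientGroup.mk_surjective c
  -- `τ • y / y` is a principal idele `(a τ)`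
  have hmem : ∀ τ : E ≃ₐ[M] E, ∃ k : Eˣ, IdeleHerbrand.principal E k = τ • y / y := fun τ => by
    have h := hc τ
    rw [classGalAct_mk, QuotientGroup.eq] at h
    have h' := (principalIdeles E).inv_mem h
    rw [mul_inv_rev, inv_inv, mul_comm, ← div_eq_mul_inv] at h'
    obtain ⟨k, hk⟩ := h'
    exact ⟨k, hk⟩
  choose a ha using hmem
  -- `a` is a `1`-cocycle `Gal(E/M) → Eˣ`
  have hcoc : groupCohomology.IsMulCocycle₁ a := by
    intro τ₁ τ₂
    apply IdeleHerbrand.principal_injective (E := E)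
    rw [map_mul, IdeleHerbrand.principal_smul, ha, ha, ha, mul_smul, smul_div', div_mul_div_cancel]
  obtain ⟨b, hb⟩ := groupCohomology.isMulCoboundary₁_of_isMulCocycle₁_of_aut_to_units a hcoc
  -- `y / (b)` is `Gal(E/M)`-fixed
  have hfix : ∀ τ : E ≃ₐ[M] E, τ • (y / IdeleHerbrand.principal E b) = y / IdeleHerbrand.principal E b :=
    fun τ => by
    have h1 : τ • y = IdeleHerbrand.principal E (a τ) * y := (eq_div_iff_mul_eq'.mp (ha τ)).symm
    rw [smul_div', h1, ← IdeleHerbrand.principal_smul, ← hb τ, map_div, div_mul_eq_mul_div, div_div,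
      mul_comm (IdeleHerbrand.principal E b), mul_div_mul_left_eq_div]
  obtain ⟨x, hx⟩ := AdeleRing.mem_range_ideleBaseChange_of_forall_smul_eq M E hfix
  refine ⟨(x : IdeleClassGroup M), ?_⟩
  rw [classBaseChange_mk, hx, QuotientGroup.eq, inv_div, div_mul_cancel]
  exact ⟨b, rfl⟩

/-- Base change twists the Galois action by restriction: `g • ι(a) = ι(g|_M • a)` on idele classes, for a
tower `F ⊆ M ⊆ E` with `M/F` normal (`AdeleRing.smul_ideleBaseChange_tower`).
[cite: CasselsFrohlichANT1967, Ch. VII §1.1] -/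
theorem classGalAct_classBaseChange_tower {F : Type} [Field F] [NumberField F] [Algebra F M] [Algebra F E]
    [IsScalarTower F M E] [Normal F M] (g : E ≃ₐ[F] E) (a : IdeleClassGroup M) :
    classGalAct g (classBaseChange M E a) = classBaseChange M E (classGalAct (g.restrictNormal M) a) := by
  induction a using QuotientGroup.induction_on with
  | H x => rw [classBaseChange_mk, classGalAct_mk, classGalAct_mk, classBaseChange_mk,
      AdeleRing.smul_ideleBaseChange_tower]

omit [NumberField M] in
/-- The action of `τ ∈ Gal(E/M)` on `C_E` is that of `τ` regarded in `Gal(E/F)` (`restrictScalars`): the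
action on `𝕀_E` only depends on the underlying field automorphism
(`NumberFields.ideleGroup.smul_eq_smul_of_forall_apply_eq`). [cite: CasselsFrohlichANT1967, Ch. VII §1.1] -/
theorem classGalAct_restrictScalars {F : Type} [Field F] [Algebra F M] [Algebra F E] [IsScalarTower F M E]
    (τ : E ≃ₐ[M] E) (c : IdeleClassGroup E) :
    classGalAct (τ.restrictScalars F) c = classGalAct τ c := by
  induction c using QuotientGroup.induction_on with
  | H y => rw [classGalAct_mk, classGalAct_mk,
      Literature.NumberTheory.NumberFields.ideleGroup.smul_eq_smul_of_forall_apply_eq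
        (σ := τ.restrictScalars F) (σ' := τ) (fun _ => rfl)]

end Descent

/-! ## §3. The inflation–restriction step -/

section Tower

variable {F M E : Type} [Field F] [Field M] [Field E] [Algebra F M] [Algebra M E] [Algebra F E]
  [IsScalarTower F M E]

/-- `restrictScalars F : Gal(E/M) → Gal(E/F)` is multiplicative. [folklore] -/
private theorem restrictScalars_mul (τ₁ τ₂ : E ≃ₐ[M] E) :
    (τ₁ * τ₂).restrictScalars F = τ₁.restrictScalars F * τ₂.restrictScalars F :=
  AlgEquiv.ext fun _ => rfl

/-- An element of `Gal(E/M)` restricts trivially to the normal intermediate extension `M`. [folklore] -/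
private theorem restrictNormal_restrictScalars [Normal F M] (τ : E ≃ₐ[M] E) :
    (τ.restrictScalars F).restrictNormal M = 1 :=
  AlgEquiv.ext fun m => (algebraMap M E).injective (by
    rw [AlgEquiv.restrictNormal_commutes, AlgEquiv.one_apply]
    exact τ.commutes m)

/-- **The kernel of `Gal(E/F) → Gal(M/F)` is `Gal(E/M)`**: an `F`-automorphism of `E` restricting
trivially to the normal intermediate extension `M` is `M`-linear. [folklore] -/
private theorem exists_restrictScalars_eq_of_restrictNormal_eq_one [Normal F M] (g : E ≃ₐ[F] E)
    (hg : g.restrictNormal M = 1) : ∃ τ : E ≃ₐ[M] E, τ.restrictScalars F = g := by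
  refine ⟨{ g.toRingEquiv with commutes' := fun m => ?_ }, AlgEquiv.ext fun _ => rfl⟩
  have h := AlgEquiv.restrictNormal_commutes g M m
  rw [hg, AlgEquiv.one_apply] at h
  exact h.symm

variable [NumberField F] [NumberField M] [NumberField E]

/-- **Inflation–restriction for `C_E`, element form** (Tate, Cassels–Fröhlich Ch. VII §9, proof of
Thm. 9.1: `0 → H¹(G/N, C_E^N) → H¹(G, C_E) → H¹(N, C_E)` with `C_E^N = C_M`).  Let `F ⊆ M ⊆ E` be number
fields with `E/F`, `M/F` and `E/M` Galois, `G = Gal(E/F)`, `N = Gal(E/M)`, `G/N = Gal(M/F)`.  If every crossed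
homomorphism `N → C_E` and every crossed homomorphism `Gal(M/F) → C_M` is a coboundary, then every crossed
homomorphism `G → C_E` is a coboundary — the elementary criterion
`CrossedHomElem.exists_coboundary_of_inflation_restriction` with `r = restrictScalars`,
`q = restrictNormalHom M`, `ι = classBaseChange M E` and the descent of §2.
[cite: CasselsFrohlichANT1967, Ch. VII §9 Thm. 9.1 (proof)] -/
theorem exists_classGalAct_div_eq_of_tower [IsGalois F E] [IsGalois F M] [IsGalois M E]
    (hN : ∀ f : (E ≃ₐ[M] E) → IdeleClassGroup E, (∀ g h, f (g * h) = classGalAct g (f h) * f g) →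
      ∃ c : IdeleClassGroup E, ∀ g, classGalAct g c / c = f g)
    (hQ : ∀ f : (M ≃ₐ[F] M) → IdeleClassGroup M, (∀ g h, f (g * h) = classGalAct g (f h) * f g) →
      ∃ c : IdeleClassGroup M, ∀ g, classGalAct g c / c = f g)
    (f : (E ≃ₐ[F] E) → IdeleClassGroup E) (hf : ∀ g h, f (g * h) = classGalAct g (f h) * f g) :
    ∃ c : IdeleClassGroup E, ∀ g, classGalAct g c / c = f g := by
  -- the restriction `Gal(E/M) →* Gal(E/F)`
  let r : (E ≃ₐ[M] E) →* (E ≃ₐ[F] E) := MonoidHom.mk' (fun τ => τ.restrictScalars F) restrictScalars_mul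
  have hr : ∀ τ : E ≃ₐ[M] E, r τ = τ.restrictScalars F := fun _ => rfl
  refine CrossedHomElem.exists_coboundary_of_inflation_restriction
    (fun g : E ≃ₐ[F] E => (classGalAct g : IdeleClassGroup E →ₜ* IdeleClassGroup E).toMonoidHom)
    (fun x : M ≃ₐ[F] M => (classGalAct x : IdeleClassGroup M →ₜ* IdeleClassGroup M).toMonoidHom)
    r (AlgEquiv.restrictNormalHom M) (classBaseChange M E)
    classGalAct_toMonoidHom_mul (AlgEquiv.restrictNormalHom_surjective E)
    (fun τ => restrictNormal_restrictScalars (F := F) τ)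
    (fun g hg => exists_restrictScalars_eq_of_restrictNormal_eq_one g hg)
    (classBaseChange_injective M E)
    (fun g a => classGalAct_classBaseChange_tower g a)
    (fun c hc => exists_classBaseChange_eq_of_forall_classGalAct_eq c fun τ => ?_)
    (fun f' hf' => hN f' fun τ₁ τ₂ => ?_) hQ hf
  · -- `N`-fixed: the action of `τ` on `C_E` is that of `r τ`
    rw [← classGalAct_restrictScalars (F := F)]
    exact hc τ
  · rw [hf' τ₁ τ₂, hr]
    exact congrArg (· * f' τ₁) (classGalAct_restrictScalars (F := F) τ₁ (f' τ₂))

end Tower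

end IdeleClassGroup

end Literature.NumberTheory.Automorphic

end
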